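import Summits.Ventures.HodgeRepro.CosetQuadCore

/-!
# The two coset mechanisms exist exactly from degrees `16` and `24` on

Blind re-derivation cell `pub-hodge-repro`, seat `p1` (gen 10).  Converses of gen 6's two threshold
theorems `sixteen_le_card_of_cyclicQuad` (`CyclicCosetThreshold.lean`) and
`twentyfour_le_card_of_kleinQuad` (`KleinCosetThreshold.lean`), for EVERY finite group `G` with a
complex conjugation `c`:

* `exists_cyclicQuad`: if `a` has order `4` with `a² ≠ c` and `16 ≤ |G|`, some CM type `Φ` has
  `Φ, Φa, Φa², Φa³` `SumTwo` without a conjugate pair;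
* `exists_kleinQuad`: if `{1, a, b, ab}` is a Klein subgroup not containing `c` and `24 ≤ |G|`, some CM
  type `Φ` has `Φ, Φa, Φb, Φab` `SumTwo` without a conjugate pair;
* `exists_cyclicQuad_iff` / `exists_kleinQuad_iff`: given the subgroup, the mechanism exists IFF
  `16 ≤ |G|` / `24 ≤ |G|`.

So the degree-16 witness (`SingleClass16Witness.lean`, `C₄ × C₄`) and the degree-24 Klein witness
(`SingleClass24Witness.lean`, `C₆ × C₂ × C₂`) are the first members of two families that exist in EVERY
finite `(G, c)` carrying the subgroup: a `K'`-Weil class (`K' = F^Δ` the CM subfield of index `4`) of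
codimension `2` on a CM abelian variety with Galois CM field `F` of degree `≥ 16` (cyclic `Δ`) or
`≥ 24` (Klein `Δ`) — the thresholds are sharp in every group, not only in the two witnesses.

Construction (the same for both mechanisms).  Let `Δ` be the order-`4` subgroup and `H' = Δ × ⟨c⟩`
(order `8`, the range of an injective hom `ψ : P →* G` from the abstract group `P`).  Every `x ∈ G` is
uniquely `x = r · ψ p` with `r` the chosen representative of its left coset `x H'` and `p ∈ P` its
COORDINATE (`coord`).  A CM type is cut out by a PATTERN `χ : L → P → Bool` on the coordinates,
chosen per coset through a LABEL `lab : G ⧸ H' → L`: `Φ = {x : χ (lab (x H')) (coord x)}` (`typeOf`).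
The pattern fixes the trace of `Φ` on each coset `x Δ` to a `2`-subset `S` of `Δ` and the
complementary trace on `c x Δ`: `SumTwo` holds because every coset `x Δ` meets `Φ` in exactly two
elements, and a conjugate pair `Φ h c = Φ` (`h ∈ Δ`) would force `S h = Δ ∖ S` on every coset —
impossible as soon as two (cyclic: `{1, a²}` and `{1, a}`) / three (Klein: `{1, a}`, `{1, b}`,
`{1, ab}`) cosets carry `2`-subsets of different stabiliser types, which needs `|G| / 8 ≥ 2` / `≥ 3`.
The three local conditions on the pattern are checked by `decide` on `P`; the transport from `P` to
`G` is the generic theorem `exists_quad_of_pattern` of part 1, `CosetQuadCore.lean` (this file is part 2 of 2 —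
split at a section boundary for the cell's ≤ 400-line landing rule, declaration text unchanged, this part keeping the
module name).
-/

set_option autoImplicit false

open Finset
open scoped Pointwise

namespace HodgeRepro.CosetQuad

variable {G : Type*} [Group G]

/-! ### The cyclic mechanism: `Δ = ⟨a⟩` of order `4`, `a² ≠ c` -/

section Cyclic

/-- The abstract group `ℤ/4 × ℤ/2` of the cyclic mechanism. -/
abbrev P4 : Type := Multiplicative (ZMod 4) × Multiplicative (ZMod 2)

/-- The hom `ℤ/4 × ℤ/2 →* G`, `(i, e) ↦ aⁱ cᵉ`, for a complex conjugation `c` and `a` of order `4`. -/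
def cyclicHom {c : G} (hc : IsComplexConj c) {a : G} (ha : orderOf a = 4) : P4 →* G :=
  (zmodPowHom 4 a (by rw [← ha, pow_orderOf_eq_one])).noncommCoprod (zmodPowHom 2 c (conj_sq_eq_one hc))
    fun _ _ => Commute.pow_pow (hc.comm a).symm _ _

/-- `cyclicHom (i, e) = aⁱ cᵉ`. -/
theorem cyclicHom_apply {c : G} (hc : IsComplexConj c) {a : G} (ha : orderOf a = 4) (p : P4) :
    cyclicHom hc ha p = a ^ (Multiplicative.toAdd p.1).val * c ^ (Multiplicative.toAdd p.2).val := rfl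

/-- `cyclicHom` is injective: `aⁱ cᵉ = 1` forces `i = 0`, `e = 0` (`a` has order `4`, `c ∉ ⟨a⟩`). -/
theorem cyclicHom_injective {c : G} (hc : IsComplexConj c) {a : G} (ha : orderOf a = 4)
    (hac : a ^ 2 ≠ c) : Function.Injective (cyclicHom hc ha) := by
  rw [injective_iff_map_eq_one]
  rintro ⟨i, e⟩ hp
  rw [cyclicHom_apply] at hp
  dsimp only at hp
  have hi4 := ZMod.val_lt (Multiplicative.toAdd i)
  have he2 := ZMod.val_lt (Multiplicative.toAdd e)
  have key : (Multiplicative.toAdd i).val = 0 ∧ (Multiplicative.toAdd e).val = 0 := by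
    have hev : (Multiplicative.toAdd e).val = 0 ∨ (Multiplicative.toAdd e).val = 1 := by omega
    rcases hev with hev | hev
    · rw [hev, pow_zero, mul_one] at hp
      have hdvd := orderOf_dvd_of_pow_eq_one hp
      rw [ha] at hdvd
      omega
    · rw [hev, pow_one] at hp
      have hac' : a ^ (Multiplicative.toAdd i).val = c := by
        rw [← hc.inv_eq]; exact eq_inv_of_mul_eq_one_left hp
      exfalso
      have hiv : (Multiplicative.toAdd i).val = 0 ∨ (Multiplicative.toAdd i).val = 1 ∨
          (Multiplicative.toAdd i).val = 2 ∨ (Multiplicative.toAdd i).val = 3 := by omega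
      rcases hiv with h0 | h1 | h2 | h3
      · rw [h0, pow_zero] at hac'; exact hc.ne_one hac'.symm
      · rw [h1, pow_one] at hac'
        have h2 : a ^ 2 = 1 := by rw [pow_two, hac', hc.mul_self]
        have := orderOf_dvd_of_pow_eq_one h2
        rw [ha] at this
        exact absurd this (by omega)
      · rw [h2] at hac'; exact hac hac'
      · rw [h3] at hac'
        have h6 : a ^ 6 = 1 := by
          rw [show (6 : ℕ) = 3 + 3 by rfl, pow_add, hac', hc.mul_self]
        have := orderOf_dvd_of_pow_eq_one h6
        rw [ha] at this
        exact absurd this (by omega)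
  have hi : i = 1 := by
    rw [← ofAdd_toAdd i, (ZMod.val_eq_zero _).1 key.1, ofAdd_zero]
  have he : e = 1 := by
    rw [← ofAdd_toAdd e, (ZMod.val_eq_zero _).1 key.2, ofAdd_zero]
  rw [hi, he]
  rfl

/-- The twists of the cyclic mechanism: `t i = (i, 0)`, so `ψ (t i) = aⁱ`. -/
def cyclicTwist (i : Fin 4) : P4 := (Multiplicative.ofAdd (i.val : ZMod 4), 1)

/-- `cyclicHom (cyclicTwist i) = a ^ i`. -/
theorem cyclicHom_twist {c : G} (hc : IsComplexConj c) {a : G} (ha : orderOf a = 4) (i : Fin 4) :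
    cyclicHom hc ha (cyclicTwist i) = a ^ i.val := by
  rw [cyclicHom_apply]
  show a ^ ((i.val : ZMod 4)).val * c ^ (0 : ZMod 2).val = a ^ i.val
  rw [ZMod.val_natCast, Nat.mod_eq_of_lt i.isLt, ZMod.val_zero, pow_zero, mul_one]

/-- `cyclicQuad Φ a` is the quadruple of twists by the `cyclicHom (cyclicTwist i)`. -/
theorem cyclicQuad_eq_twists (Φ : Finset G) {c : G} (hc : IsComplexConj c) {a : G}
    (ha : orderOf a = 4) :
    cyclicQuad Φ a = fun i => rmul Φ (cyclicHom hc ha (cyclicTwist i)) := by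
  funext i
  rw [cyclicHom_twist]
  fin_cases i
  · show Φ = rmul Φ (a ^ 0)
    rw [pow_zero, rmul_one]
  · show rmul Φ a = rmul Φ (a ^ 1)
    rw [pow_one]
  · rfl
  · rfl

/-- The cyclic pattern.  Label `0`: the trace of `Φ` on the coset is `{1, a²}` (a coset of `⟨a²⟩`);
label `1`: the trace is `{1, a}` (a `2`-subset that is a coset of no subgroup); on the conjugate coset
(`e = 1`) the complement. -/
def cyclicPattern (l : Fin 2) (p : P4) : Bool :=
  let inS : Bool :=
    if l = 0 then decide (Multiplicative.toAdd p.1 = 0 ∨ Multiplicative.toAdd p.1 = 2)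
    else decide (Multiplicative.toAdd p.1 = 0 ∨ Multiplicative.toAdd p.1 = 1)
  if Multiplicative.toAdd p.2 = 0 then inS else !inS

/-- The element `(0, 1)` of `P4`, mapped to `c`. -/
def cyclicConj : P4 := (1, Multiplicative.ofAdd 1)

/-- `cyclicHom cyclicConj = c`. -/
theorem cyclicHom_conj {c : G} (hc : IsComplexConj c) {a : G} (ha : orderOf a = 4) :
    cyclicHom hc ha cyclicConj = c := by
  rw [cyclicHom_apply]
  show a ^ (0 : ZMod 4).val * c ^ (1 : ZMod 2).val = c
  rw [ZMod.val_zero, pow_zero, one_mul, val_one_two, pow_one]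

/-- **The cyclic mechanism exists from degree `16` on.**  For every finite `(G, c)` and every `a` of
order `4` with `a² ≠ c`: if `16 ≤ |G|`, some CM type `Φ` has `Φ, Φa, Φa², Φa³` `SumTwo` without a
conjugate pair — the converse of `sixteen_le_card_of_cyclicQuad`. -/
theorem exists_cyclicQuad [Fintype G] [DecidableEq G] {c : G} (hc : IsComplexConj c) {a : G}
    (ha : orderOf a = 4) (hac : a ^ 2 ≠ c) (hG : 16 ≤ Fintype.card G) :
    ∃ Φ : Finset G, IsCMType c Φ ∧ SumTwo (cyclicQuad Φ a) ∧
      ∀ i j : Fin 4, cyclicQuad Φ a j ≠ c • cyclicQuad Φ a i := by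
  have hcard : Fintype.card (Fin 2) * Fintype.card P4 ≤ Fintype.card G := by
    rw [Fintype.card_fin, show Fintype.card P4 = 8 from rfl]
    exact hG
  obtain ⟨Φ, h1, h2, h3⟩ := exists_quad_of_pattern (cyclicHom hc ha) (cyclicHom_injective hc ha hac)
    hc (cyclicHom_conj hc ha) cyclicTwist cyclicPattern (by decide) (by decide) (by decide) hcard
  refine ⟨Φ, h1, ?_, ?_⟩
  · rw [cyclicQuad_eq_twists Φ hc ha]; exact h2
  · rw [cyclicQuad_eq_twists Φ hc ha]; exact h3

/-- **The cyclic-coset criterion.**  Given `a` of order `4` with `a² ≠ c`, a CM type whose twists by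
`1, a, a², a³` are `SumTwo` without a conjugate pair exists IFF `16 ≤ |G|`. -/
theorem exists_cyclicQuad_iff [Fintype G] [DecidableEq G] {c : G} (hc : IsComplexConj c) {a : G}
    (ha : orderOf a = 4) (hac : a ^ 2 ≠ c) :
    (∃ Φ : Finset G, IsCMType c Φ ∧ SumTwo (cyclicQuad Φ a) ∧
      ∀ i j : Fin 4, cyclicQuad Φ a j ≠ c • cyclicQuad Φ a i) ↔ 16 ≤ Fintype.card G :=
  ⟨fun ⟨_, hΦ, hs, hnc⟩ => sixteen_le_card_of_cyclicQuad hc hΦ ha hac hs hnc,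
    fun h => exists_cyclicQuad hc ha hac h⟩

end Cyclic

/-! ### The Klein mechanism: `Δ = {1, a, b, ab}` not containing `c` -/

section Klein

/-- The abstract group `ℤ/2 × ℤ/2 × ℤ/2` of the Klein mechanism. -/
abbrev P8 : Type := Multiplicative (ZMod 2) × (Multiplicative (ZMod 2) × Multiplicative (ZMod 2))

/-- The hom `ℤ/2 × ℤ/2 × ℤ/2 →* G`, `(i, j, e) ↦ aⁱ bʲ cᵉ`, for a complex conjugation `c` and
commuting involutions `a`, `b`. -/
def kleinHom {c : G} (hc : IsComplexConj c) {a b : G} (ha : a * a = 1) (hb : b * b = 1)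
    (hab : a * b = b * a) : P8 →* G :=
  (zmodPowHom 2 a (by rw [pow_two, ha])).noncommCoprod
    ((zmodPowHom 2 b (by rw [pow_two, hb])).noncommCoprod (zmodPowHom 2 c (conj_sq_eq_one hc))
      fun _ _ => Commute.pow_pow (hc.comm b).symm _ _)
    fun _ _ => Commute.mul_right (Commute.pow_pow hab _ _) (Commute.pow_pow (hc.comm a).symm _ _)

/-- `kleinHom (i, j, e) = aⁱ bʲ cᵉ`. -/
theorem kleinHom_apply {c : G} (hc : IsComplexConj c) {a b : G} (ha : a * a = 1) (hb : b * b = 1)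
    (hab : a * b = b * a) (p : P8) :
    kleinHom hc ha hb hab p = a ^ (Multiplicative.toAdd p.1).val *
      (b ^ (Multiplicative.toAdd p.2.1).val * c ^ (Multiplicative.toAdd p.2.2).val) := rfl

/-- `kleinHom` is injective: `aⁱ bʲ cᵉ = 1` forces `i = j = e = 0` when `1, a, b, ab, c` are distinct
and `c ∉ {a, b, ab}`. -/
theorem kleinHom_injective {c : G} (hc : IsComplexConj c) {a b : G} (ha : a * a = 1)
    (hb : b * b = 1) (hab : a * b = b * a) (ha1 : a ≠ 1) (hb1 : b ≠ 1) (hab1 : a ≠ b) (hca : c ≠ a)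
    (hcb : c ≠ b) (hcab : c ≠ a * b) : Function.Injective (kleinHom hc ha hb hab) := by
  rw [injective_iff_map_eq_one]
  rintro ⟨i, j, e⟩ hp
  rw [kleinHom_apply] at hp
  dsimp only at hp
  have hi2 := ZMod.val_lt (Multiplicative.toAdd i)
  have hj2 := ZMod.val_lt (Multiplicative.toAdd j)
  have he2 := ZMod.val_lt (Multiplicative.toAdd e)
  have hbinv : b⁻¹ = b := inv_eq_of_mul_eq_one_right hb
  have key : (Multiplicative.toAdd i).val = 0 ∧ (Multiplicative.toAdd j).val = 0 ∧
      (Multiplicative.toAdd e).val = 0 := by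
    have hiv : (Multiplicative.toAdd i).val = 0 ∨ (Multiplicative.toAdd i).val = 1 := by omega
    have hjv : (Multiplicative.toAdd j).val = 0 ∨ (Multiplicative.toAdd j).val = 1 := by omega
    have hev : (Multiplicative.toAdd e).val = 0 ∨ (Multiplicative.toAdd e).val = 1 := by omega
    rcases hiv with hi | hi <;> rcases hjv with hj | hj <;> rcases hev with he | he <;>
      rw [hi, hj, he] at hp <;> simp only [pow_zero, pow_one, one_mul, mul_one] at hp
    · exact ⟨hi, hj, he⟩
    · exact absurd hp hc.ne_one
    · exact absurd hp hb1
    · exact absurd (eq_inv_of_mul_eq_one_left hp) (hcb.symm.trans_eq hc.inv_eq.symm)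
    · exact absurd hp ha1
    · exact absurd (eq_inv_of_mul_eq_one_left hp) (hca.symm.trans_eq hc.inv_eq.symm)
    · exact absurd ((eq_inv_of_mul_eq_one_left hp).trans hbinv) hab1
    · rw [← mul_assoc] at hp
      exact absurd (eq_inv_of_mul_eq_one_left hp) (hcab.symm.trans_eq hc.inv_eq.symm)
  have hi : i = 1 := by
    rw [← ofAdd_toAdd i, (ZMod.val_eq_zero _).1 key.1, ofAdd_zero]
  have hj : j = 1 := by
    rw [← ofAdd_toAdd j, (ZMod.val_eq_zero _).1 key.2.1, ofAdd_zero]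
  have he : e = 1 := by
    rw [← ofAdd_toAdd e, (ZMod.val_eq_zero _).1 key.2.2, ofAdd_zero]
  rw [hi, hj, he]
  rfl

/-- The twists of the Klein mechanism: `1, (1,0,0), (0,1,0), (1,1,0)`, mapped to `1, a, b, ab`. -/
def kleinTwist (i : Fin 4) : P8 :=
  ![(1, 1, 1), (Multiplicative.ofAdd 1, 1, 1), (1, Multiplicative.ofAdd 1, 1),
    (Multiplicative.ofAdd 1, Multiplicative.ofAdd 1, 1)] i

/-- The element `(0, 0, 1)` of `P8`, mapped to `c`. -/
def kleinConj : P8 := (1, 1, Multiplicative.ofAdd 1)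

/-- `kleinHom kleinConj = c`. -/
theorem kleinHom_conj {c : G} (hc : IsComplexConj c) {a b : G} (ha : a * a = 1) (hb : b * b = 1)
    (hab : a * b = b * a) : kleinHom hc ha hb hab kleinConj = c := by
  rw [kleinHom_apply]
  show a ^ (0 : ZMod 2).val * (b ^ (0 : ZMod 2).val * c ^ (1 : ZMod 2).val) = c
  simp only [ZMod.val_zero, val_one_two, pow_zero, pow_one, one_mul]

/-- `kleinQuad Φ a b` is the quadruple of twists by the `kleinHom (kleinTwist i)`. -/
theorem kleinQuad_eq_twists (Φ : Finset G) {c : G} (hc : IsComplexConj c) {a b : G} (ha : a * a = 1)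
    (hb : b * b = 1) (hab : a * b = b * a) :
    kleinQuad Φ a b = fun i => rmul Φ (kleinHom hc ha hb hab (kleinTwist i)) := by
  funext i
  rw [kleinHom_apply]
  fin_cases i
  · show Φ = rmul Φ (a ^ (0 : ZMod 2).val * (b ^ (0 : ZMod 2).val * c ^ (0 : ZMod 2).val))
    simp only [ZMod.val_zero, pow_zero, one_mul, rmul_one]
  · show rmul Φ a = rmul Φ (a ^ (1 : ZMod 2).val * (b ^ (0 : ZMod 2).val * c ^ (0 : ZMod 2).val))
    simp only [ZMod.val_zero, val_one_two, pow_zero, pow_one, mul_one]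
  · show rmul Φ b = rmul Φ (a ^ (0 : ZMod 2).val * (b ^ (1 : ZMod 2).val * c ^ (0 : ZMod 2).val))
    simp only [ZMod.val_zero, val_one_two, pow_zero, pow_one, one_mul, mul_one]
  · show rmul Φ (a * b) =
      rmul Φ (a ^ (1 : ZMod 2).val * (b ^ (1 : ZMod 2).val * c ^ (0 : ZMod 2).val))
    simp only [ZMod.val_zero, val_one_two, pow_zero, pow_one, mul_one]

/-- The Klein pattern.  Label `0`: the trace of `Φ` on the coset is `{1, a}`; label `1`: `{1, b}`;
label `2`: `{1, ab}` (cosets of the three subgroups of order `2`); on the conjugate coset (`e = 1`)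
the complement. -/
def kleinPattern (l : Fin 3) (p : P8) : Bool :=
  let inS : Bool :=
    if l = 0 then decide (Multiplicative.toAdd p.2.1 = 0)
    else if l = 1 then decide (Multiplicative.toAdd p.1 = 0)
    else decide (Multiplicative.toAdd p.1 = Multiplicative.toAdd p.2.1)
  if Multiplicative.toAdd p.2.2 = 0 then inS else !inS

/-- **The Klein mechanism exists from degree `24` on.**  For every finite `(G, c)` and every Klein
subgroup `{1, a, b, ab}` not containing `c`: if `24 ≤ |G|`, some CM type `Φ` has `Φ, Φa, Φb, Φab`
`SumTwo` without a conjugate pair — the converse of `twentyfour_le_card_of_kleinQuad`. -/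
theorem exists_kleinQuad [Fintype G] [DecidableEq G] {c : G} (hc : IsComplexConj c) {a b : G}
    (ha : a * a = 1) (hb : b * b = 1) (hab : a * b = b * a) (ha1 : a ≠ 1) (hb1 : b ≠ 1) (hab1 : a ≠ b)
    (hca : c ≠ a) (hcb : c ≠ b) (hcab : c ≠ a * b) (hG : 24 ≤ Fintype.card G) :
    ∃ Φ : Finset G, IsCMType c Φ ∧ SumTwo (kleinQuad Φ a b) ∧
      ∀ i j : Fin 4, kleinQuad Φ a b j ≠ c • kleinQuad Φ a b i := by
  have hcard : Fintype.card (Fin 3) * Fintype.card P8 ≤ Fintype.card G := by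
    rw [Fintype.card_fin, show Fintype.card P8 = 8 from rfl]
    exact hG
  obtain ⟨Φ, h1, h2, h3⟩ := exists_quad_of_pattern (kleinHom hc ha hb hab)
    (kleinHom_injective hc ha hb hab ha1 hb1 hab1 hca hcb hcab) hc (kleinHom_conj hc ha hb hab)
    kleinTwist kleinPattern (by decide) (by decide) (by decide) hcard
  refine ⟨Φ, h1, ?_, ?_⟩
  · rw [kleinQuad_eq_twists Φ hc ha hb hab]; exact h2
  · rw [kleinQuad_eq_twists Φ hc ha hb hab]; exact h3

/-- **The Klein-coset criterion.**  Given a Klein subgroup `{1, a, b, ab}` not containing `c`, a CM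
type whose twists by `1, a, b, ab` are `SumTwo` without a conjugate pair exists IFF `24 ≤ |G|`. -/
theorem exists_kleinQuad_iff [Fintype G] [DecidableEq G] {c : G} (hc : IsComplexConj c) {a b : G}
    (ha : a * a = 1) (hb : b * b = 1) (hab : a * b = b * a) (ha1 : a ≠ 1) (hb1 : b ≠ 1) (hab1 : a ≠ b)
    (hca : c ≠ a) (hcb : c ≠ b) (hcab : c ≠ a * b) :
    (∃ Φ : Finset G, IsCMType c Φ ∧ SumTwo (kleinQuad Φ a b) ∧
      ∀ i j : Fin 4, kleinQuad Φ a b j ≠ c • kleinQuad Φ a b i) ↔ 24 ≤ Fintype.card G :=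
  ⟨fun ⟨_, hΦ, hs, hnc⟩ =>
      twentyfour_le_card_of_kleinQuad hc hΦ ha hb hab ha1 hb1 hab1 hca hcb hcab hs hnc,
    fun h => exists_kleinQuad hc ha hb hab ha1 hb1 hab1 hca hcb hcab h⟩

end Klein

end HodgeRepro.CosetQuad
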